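import Mathlib.Init
import Summits.Ventures.PercRepro.C026ThreePlanes

/-!
# Bit-planes for the 6-vertex gadget, 0′: the factor-2 table (p5, gen 13)

A second kernel evaluation over the planes of `C026ThreePlanes` (its own module: one `2^24`-bit
evaluation per file keeps clear of the kernel's memory guard): mine-3's S8 `2·#KL ≤ #Kc + #Lc`, cell by cell.
`Mathlib.Init` is imported only so that the gate's axiom audit can run (`CoreM`); it does not disturb the
kernel evaluation (9 s, axioms `[propext]`).
-/

namespace PercRepro

namespace Plane6

/-- **THE FACTOR-2 TABLE** (mine-3's S8 `2·#KL ≤ #Kc + #Lc`, cell by cell): the `KL` plane is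
`bot ∧ BAD ∧ ¬o1 ∧ ¬o2`, the `Kc` / `Lc` planes are `bot ∧ ¬BAD ∧ o1` / `bot ∧ ¬BAD ∧ o2`; the left
number is `2·KL` (a zero low plane), the right number is `Kc + Lc`. -/
theorem tableF2 :
    ltP (levels 12 [(bot &&& notP BAD &&& o1) ^^^ (bot &&& notP BAD &&& o2),
        (bot &&& notP BAD &&& o1) &&& (bot &&& notP BAD &&& o2)])
      (levels 12 [0, bot &&& BAD &&& notP o1 &&& notP o2]) 0 &&& valid = 0 := by
  decide +kernel

end Plane6

end PercRepro
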